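import Summits.QuantumFields.YangMills.Theorems.F4SubCurvatureDoorShortRootRigidityPlanarInitialAperture
import Mathlib
import HarnessLib

/-!
# LINE g20-A «angular type» (crux ⟨stmt-QuantumFields-23035⟩ `ShortRootRigidity`) — `PlanarConeSupport ⇐ PlanarApertureStep` as a tree theorem

Owner file `Cruxes/ShortRootRigidity/Lines/angular_type_rungs.lean` v3 (planner ym-idea-3 g21, sha16 a8a830bd1d79bc63).  The owner's PROVED
reduction `planarConeSupport_of_step : PlanarInitialAperture → PlanarApertureStep → PlanarConeSupport` lives in a `Cruxes/` file (not importable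
from `Theorems/`); this file restates `PlanarApertureStep` and `PlanarConeSupport` CHARACTER-IDENTICALLY (over the landed `IsPlanarLF` /
`HasAperture` of `…PlanarInitialAperture`), re-proves the owner's `hasAperture_mono`, `hasAperture_of_tendsto`, `planarConeSupport_of_step`
verbatim, and feeds the landed rung R-S3c `planarInitialAperture_holds` (this seat, p722363):

  `planarConeSupport_of_apertureStep : PlanarApertureStep → PlanarConeSupport`

— the support form of (C) `stub_planarSpectralCone` now hinges, AS A TREE THEOREM, on the single typed statement R-S3d `PlanarApertureStep`
(whose local SCV input R-S3a/R-S3b is landed/landing: p722711, `…FlatDoubleEdge`).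

HONEST LABEL: assembly of rungs of the OPEN stub (C); R-S3d (THE step), (C), ⟨23035⟩, ⟨23125⟩, R2d and the Yang–Mills mass gap remain OPEN; no
summit is proved by a line.  Lead seat `ym-line-sfw-p2` g75 (cell ym-idea-1, free hands); the three re-proved lemmas are the owner's.
-/

set_option autoImplicit false

noncomputable section

open MeasureTheory Filter Topology Set
open scoped Topology

namespace Summit.QuantumFields.YangMills.Theorems.F4SubCurvatureDoorPlanarConeSupportRegistered

open Summit.QuantumFields.YangMills.Theorems.F4SubCurvatureDoorSliceDensityRegistered (E2)
open Summit.QuantumFields.YangMills.Theorems.F4SubCurvatureDoorSliceInClassRegistered (InPlanarClass)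
open Summit.QuantumFields.YangMills.Theorems.F4SubCurvatureDoorPlanarInitialApertureRegistered
  (IsPlanarLF HasAperture PlanarInitialAperture planarInitialAperture_holds)

/-! ## The Props (character-identical with `Lines/angular_type_rungs.lean` v3) -/

/-- **R-S3d · PlanarApertureStep** (target, L — THE S3 STEP): below slope `1`, every valid aperture improves, by an amount that may depend on
`τ` but NOT on `k`, `μ`, `t`.  Proof plan (section docstring): three frame tubes of aperture `τ` (D₆: the SAME `μ`-aperture in the frames at
`±60°`, by `hexReflection`/rotation invariance of `InPlanarClass` and uniqueness of the frame measure) ⇒ `FlatDoubleEdge` at `(t, ±iτt)` with the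
pinning bound ⇒ Lukacs on the line `ζ = t` ⇒ moments of aperture `τ + δ′` bounded by `2M` for all `t` ⇒ pinning.  At `τ = 1` the conormals are
ℂ-proportional and the light cone IS a natural boundary (`K₀(m‖y‖)`), so the hypothesis `τ < 1` is sharp.  WHY IT MIGHT FAIL: it should not;
the one delicate point is the identification of the three frame transforms as ONE holomorphic function on the union of the tubes (identity
theorem on the pairwise intersections, which are convex hence connected, through the common real sector). -/
def PlanarApertureStep : Prop :=
  ∀ τ : ℝ, 0 < τ → τ < 1 → ∃ τ' : ℝ, τ < τ' ∧
    ∀ (k : E2 → ℝ) (μ : Measure (ℝ × ℝ)), InPlanarClass k → IsPlanarLF k μ → HasAperture μ τ → HasAperture μ τ'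

/-- **PlanarConeSupport** (the support form of (C)): the frame Laplace–Fourier measure of a planar class kernel is carried by the forward light
cone `{E ≥ |p|}`.  (C) `PlanarSpectralCone k` is its tube packaging (card S4; `planarNarrowTube`'s proof with `c = 1` and the cone majorant). -/
def PlanarConeSupport : Prop :=
  ∀ (k : E2 → ℝ) (μ : Measure (ℝ × ℝ)), InPlanarClass k → IsPlanarLF k μ → HasAperture μ 1

/-! ## The owner's reduction (planner ym-idea-3 g21), re-proved verbatim -/

/-- Monotonicity of apertures. -/
theorem hasAperture_mono {μ : Measure (ℝ × ℝ)} {σ τ : ℝ} (h : HasAperture μ τ) (hστ : σ ≤ τ) : HasAperture μ σ := by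
  refine measure_mono_null (fun z hz => ?_) h
  simp only [Set.mem_setOf_eq] at hz ⊢
  exact lt_of_lt_of_le hz (mul_le_mul_of_nonneg_right hστ (abs_nonneg _))

/-- Apertures are closed under limits: if every `τ n` is a valid aperture and `τ n → τ⋆`, then `τ⋆` is one (the strict sub-cone of slope
`τ⋆` is the union of the sub-cones of slopes `τ n`, by continuity of measure). -/
theorem hasAperture_of_tendsto {μ : Measure (ℝ × ℝ)} {τ : ℕ → ℝ} {τs : ℝ} (h : ∀ n, HasAperture μ (τ n))
    (hlim : Filter.Tendsto τ Filter.atTop (𝓝 τs)) : HasAperture μ τs := by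
  have hsub : {z : ℝ × ℝ | z.1 < τs * |z.2|} ⊆ ⋃ n, {z : ℝ × ℝ | z.1 < τ n * |z.2|} := by
    intro z hz
    simp only [Set.mem_setOf_eq] at hz
    simp only [Set.mem_iUnion, Set.mem_setOf_eq]
    by_cases hp : z.2 = 0
    · refine ⟨0, ?_⟩
      simpa [hp] using hz
    · have hpos : 0 < |z.2| := abs_pos.mpr hp
      -- `z.1 / |z.2| < τs`, so eventually `z.1 / |z.2| < τ n`
      have hlt : z.1 / |z.2| < τs := by rwa [div_lt_iff₀ hpos]
      have hev : ∀ᶠ n in Filter.atTop, z.1 / |z.2| < τ n := hlim.eventually (eventually_gt_nhds hlt)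
      obtain ⟨n, hn⟩ := hev.exists
      exact ⟨n, by rwa [div_lt_iff₀ hpos] at hn⟩
  exact measure_mono_null hsub (measure_iUnion_null fun n => h n)

/-- **The S3 bootstrap, assembled (PROVED): initial aperture + the step below slope `1` ⇒ the light cone.**  The set of valid apertures in
`[0, 1]` contains `min c 1 > 0`, is closed under suprema (`hasAperture_of_tendsto`), and cannot have supremum `< 1` (the step would exceed it). -/
theorem planarConeSupport_of_step (hinit : PlanarInitialAperture) (hstep : PlanarApertureStep) : PlanarConeSupport := by
  intro k μ hk hμ
  obtain ⟨c, hc, hcμ⟩ := hinit k hk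
  have h0 : HasAperture μ (min c 1) := hasAperture_mono (hcμ μ hμ) (min_le_left _ _)
  -- the set of valid apertures in `[0, 1]`
  set T : Set ℝ := {σ : ℝ | σ ≤ 1 ∧ HasAperture μ σ} with hT
  have hTne : T.Nonempty := ⟨min c 1, min_le_right _ _, h0⟩
  have hTbdd : BddAbove T := ⟨1, fun σ hσ => hσ.1⟩
  have hmem : min c 1 ∈ T := ⟨min_le_right _ _, h0⟩
  -- its supremum is a valid aperture
  obtain ⟨u, _, hulim, huT⟩ := exists_seq_tendsto_sSup hTne hTbdd
  have hsup : HasAperture μ (sSup T) := hasAperture_of_tendsto (fun n => (huT n).2) hulim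
  have hsup_le : sSup T ≤ 1 := csSup_le hTne fun σ hσ => hσ.1
  have hsup_pos : 0 < sSup T := lt_of_lt_of_le (lt_min hc one_pos) (le_csSup hTbdd hmem)
  -- and it equals `1`
  by_cases h1 : sSup T < 1
  · exfalso
    obtain ⟨τ', hτ', hstep'⟩ := hstep (sSup T) hsup_pos h1
    have hτ'ap : HasAperture μ (min τ' 1) := hasAperture_mono (hstep' k μ hk hμ hsup) (min_le_left _ _)
    have hmem' : min τ' 1 ∈ T := ⟨min_le_right _ _, hτ'ap⟩
    have : min τ' 1 ≤ sSup T := le_csSup hTbdd hmem'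
    have h2 : sSup T < min τ' 1 := lt_min hτ' h1
    linarith
  · have heq : sSup T = 1 := le_antisymm hsup_le (not_lt.mp h1)
    simpa [PlanarConeSupport, heq] using hsup

/-- **(C), support form, ⇐ R-S3d**: with the initial aperture a theorem (R-S3c, p722363), `PlanarConeSupport` follows from `PlanarApertureStep`. -/
theorem planarConeSupport_of_apertureStep (hstep : PlanarApertureStep) : PlanarConeSupport :=
  planarConeSupport_of_step planarInitialAperture_holds hstep

end Summit.QuantumFields.YangMills.Theorems.F4SubCurvatureDoorPlanarConeSupportRegistered

end
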